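import Summits.ResolutionOfSingularities.ResolutionOfSingularities.Theorems.FrobeniusClosingPatchingRelPerfectChartStrictHypersurface
import Summits.ResolutionOfSingularities.ResolutionOfSingularities.Theorems.FrobeniusClosingPatchingRelPerfectCoreRungTowerCharts
import Literature.AlgebraicGeometry.Resolution.BlowupAlgebraPresentation
import Literature.AlgebraicGeometry.Resolution.CoordinateBlowupChart
import HarnessLib

/-!
# Crux `PatchingRelPerfect` (stmt-ResolutionOfSingularities-16161), chain w52 — the rank-two member
# `f = x₀x₁ + x₂³`: the POINT step — polynomial model of the strict transform of `E = V(t)`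

[OURS · L1 W5.2 · rung tool, design note NEXT-two-planes-cube.md Addendum 12]  Abstract setting of
`…TwoPlanesPointQIdeals`: a ring `C`, a point family `qq = (t, p, a, b)` and a COORDINATE MODEL of
the hypersurface `E = V(t)`: a surjection `q : C → Λ[X_σ]` with kernel `(t)` taking `p, a, b` to
distinct variables `X_{ι 0}, X_{ι 1}, X_{ι 2}`.  On the chart `C_{k+1}` of `Bl_q Spec C` (exceptional
`w`, `u′ = e′₀` the strict transform of `E`) we PROVE:

* `isQuasiRegular_qq`, `isDomain_quot_t`, `isDomain_quot_MQ`, `isRegularRing_quot_MQ`,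
  `cons_notMem_span_t`, `hh_notMem_span_t` — the point family is quasi-regular, `C/(t)` and `C/𝔪_q`
  are (regular) domains, `p, a, b, h″ ∉ (t)` (`h″ = p a + b³`);
* `exists_coordBlowup_model` — Hu's chart `Λ[X_σ][(X_A)/X_{i₀}] ≅ Λ[X_σ]` with its values
  (`Literature…CoordinateBlowupChart`), packaged for an element `c = X_{i₀}`;
* **`exists_pointQ_model`** — `C_{k+1} ⧸ (u′) ≅ Λ[X_σ]`, sending `ψ(r) ↦ subst_k (q r)` (Hu's
  substitution `X_{ι j} ↦ X_{ι k} X_{ι j}`, `j ≠ k`) and `e′_{j+1} ↦ X_{ι j}` (`j ≠ k`): the strict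
  transform of `E ≅ 𝔸` blown up in the point is affine space again (Görtz–Wedhorn 13.96 (2) via
  `quotientKerBlowupAlgebraMapEquiv` on the bridge `toBlowupAlgebra`, then Hu 2025 Prop. 5.3).

Nothing here is a statement of the manuscript under review.

## References

* U. Görtz, T. Wedhorn, *Algebraic Geometry I*, 2nd ed. 2020, Prop. 13.96 (2), (13.19). [GortzWedhorn2020]
* Y. Hu, *Universal characteristic-free resolution I*, arXiv:2507.21400, §5 Prop. 5.3. [Hu2025]
* The Stacks Project, Tags 0804, 0BIQ. [StacksProject]
-/

-- `Summit.<Summit>.<Sub>.Theorems` with `Sub = Summit` (single-conjunct summit, D-0017)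
set_option linter.dupNamespace false

noncomputable section

open CategoryTheory CategoryTheory.Limits AlgebraicGeometry Literature.AlgebraicGeometry.Resolution
open IsLocalRing

namespace Summit.ResolutionOfSingularities.ResolutionOfSingularities.Theorems

namespace TwoPlanesRung

open ConeRung

universe u

/-! ## Hu's chart, packaged for an element equal to a variable -/

/-- **`Λ[X_σ][(X_A)/c] ≅ Λ[X_σ]` for `c = X_{i₀}`, `i₀ ∈ A`**, with values: `r/1 ↦ subst r`,
`X_i/c ↦ X_i` (`i ∈ A`, `i ≠ i₀`). [cite: Hu2025, §5 Prop. 5.3] [cite: GortzWedhorn2020, (13.19)] -/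
theorem exists_coordBlowup_model {Λ : Type u} [CommRing Λ] {σ : Type} (A : Set σ) (i₀ : σ)
    (c : MvPolynomial σ Λ) (hc : c = MvPolynomial.X i₀) :
    ∃ E : blowupAlgebra (Ideal.span (MvPolynomial.X '' A)) c ≃+* MvPolynomial σ Λ,
      (∀ r, E (algebraMap _ _ r) = coordBlowupSubst Λ A i₀ r) ∧
      (∀ (i : σ) (hi : i ∈ A), i ≠ i₀ → ∀ hx,
        E (blowupAlgebra.gen (Ideal.span (MvPolynomial.X '' A)) c (MvPolynomial.X i) hx) = MvPolynomial.X i) := by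
  subst hc
  refine ⟨(coordBlowupChartEquiv Λ A i₀).symm.toRingEquiv, fun r => coordBlowupChartEquiv_symm_algebraMap Λ A i₀ r,
    fun i hi hne hx => ?_⟩
  have h1 : coordBlowupChartEquiv Λ A i₀ (MvPolynomial.X i) =
      blowupAlgebra.gen (Ideal.span (MvPolynomial.X '' A)) (MvPolynomial.X i₀) (MvPolynomial.X i) hx :=
    Subtype.ext (by rw [coe_coordBlowupChartEquiv_apply, coordBlowupChartMap_X_of_mem_of_ne Λ A i₀ hi hne,
      blowupAlgebra.coe_gen])
  change (coordBlowupChartEquiv Λ A i₀).symm _ = _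
  rw [← h1, AlgEquiv.symm_apply_apply]

section Model

variable {C : Type u} [CommRing C] (t p a b : C) {Λ : Type u} [CommRing Λ] {σ : Type}
  (q : C →+* MvPolynomial σ Λ) (ι : Fin 3 → σ)

local notation3 "vv" => (![p, a, b] : Fin 3 → C)
local notation3 "qq" => (Fin.cons t ![p, a, b] : Fin 4 → C)
local notation3 "MQ" => Ideal.span (Set.range (Fin.cons t ![p, a, b] : Fin 4 → C))
local notation3 "hh" => p * a + b ^ 3
local notation3 "J" => Ideal.span (MvPolynomial.X '' Set.range ι : Set (MvPolynomial σ Λ))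

/-- The values of `q` on `p, a, b` as one statement over `Fin 3`. [folklore] -/
theorem q_cons (hqp : q p = MvPolynomial.X (ι 0)) (hqa : q a = MvPolynomial.X (ι 1))
    (hqb : q b = MvPolynomial.X (ι 2)) (k : Fin 3) : q (vv k) = MvPolynomial.X (ι k) := by
  fin_cases k
  · exact hqp
  · exact hqa
  · exact hqb

/-- `q t = 0`. [folklore] -/
theorem q_t (hker : RingHom.ker q = Ideal.span {t}) : q t = 0 := by
  rw [← RingHom.mem_ker, hker]; exact Ideal.mem_span_singleton_self t

/-- **`C ⧸ (t) ≅ Λ[X_σ]`** through `q`, with values `r̄ ↦ q r`. [folklore] -/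
theorem exists_quot_t_equiv (hq : Function.Surjective q) (hker : RingHom.ker q = Ideal.span {t}) :
    ∃ ε : (C ⧸ Ideal.span {t}) ≃+* MvPolynomial σ Λ, ∀ r, ε (Ideal.Quotient.mk _ r) = q r :=
  ⟨(Ideal.quotEquivOfEq hker.symm).trans (RingHom.quotientKerEquivOfSurjective hq), fun r => by
    rw [RingEquiv.trans_apply, Ideal.quotEquivOfEq_mk]
    exact RingHom.quotientKerEquivOfSurjective_apply_mk hq r⟩

/-- `C ⧸ (t)` is a domain. [folklore] -/
theorem isDomain_quot_t [IsDomain Λ] (hq : Function.Surjective q) (hker : RingHom.ker q = Ideal.span {t}) :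
    IsDomain (C ⧸ Ideal.span {t}) := by
  obtain ⟨ε, -⟩ := exists_quot_t_equiv t q hq hker
  exact MulEquiv.isDomain (MvPolynomial σ Λ) ε.toMulEquiv

/-- **The point family `(t, p, a, b)` is quasi-regular**: `t` is a non-zero-divisor and modulo `t`
the other three are distinct variables. [cite: StacksProject, Tag 0BIQ] -/
theorem isQuasiRegular_qq (hq : Function.Surjective q) (hker : RingHom.ker q = Ideal.span {t})
    (hι : Function.Injective ι) (hqp : q p = MvPolynomial.X (ι 0)) (hqa : q a = MvPolynomial.X (ι 1))
    (hqb : q b = MvPolynomial.X (ι 2)) (ht : t ∈ nonZeroDivisors C) : IsQuasiRegular qq := by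
  obtain ⟨ε, hε⟩ := exists_quot_t_equiv t q hq hker
  refine isQuasiRegular_of_isWeaklyRegular _ (CoreRungTower.isWeaklyRegular_cons_of_quotEquiv t vv ι ε.symm
    (fun k => ?_) ht hι)
  rw [RingEquiv.symm_apply_eq, hε, q_cons p a b q ι hqp hqa hqb]

/-- `C ⧸ 𝔪_q` is a regular ring (`≅ Λ[X_j : j ∉ ι]`). [cite: StacksProject, Tag 0BIQ] -/
theorem isRegularRing_quot_MQ [IsRegularRing Λ] [Finite σ] (hq : Function.Surjective q)
    (hker : RingHom.ker q = Ideal.span {t}) (hqp : q p = MvPolynomial.X (ι 0))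
    (hqa : q a = MvPolynomial.X (ι 1)) (hqb : q b = MvPolynomial.X (ι 2)) : IsRegularRing (C ⧸ MQ) := by
  obtain ⟨ε, hε⟩ := exists_quot_t_equiv t q hq hker
  exact CoreRungTower.isRegularRing_quot_cons_of_quotEquiv t vv ι ε.symm
    (fun k => by rw [RingEquiv.symm_apply_eq, hε, q_cons p a b q ι hqp hqa hqb])

/-- **`C ⧸ 𝔪_q ≅ Λ[X_j : j ∉ ι]`** (as in `CoreRungTower.isRegularRing_quot_cons_of_quotEquiv`).
[cite: StacksProject, Tag 0BIQ] -/
theorem nonempty_quot_MQ_equiv (hq : Function.Surjective q) (hker : RingHom.ker q = Ideal.span {t})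
    (hqp : q p = MvPolynomial.X (ι 0)) (hqa : q a = MvPolynomial.X (ι 1))
    (hqb : q b = MvPolynomial.X (ι 2)) :
    Nonempty ((C ⧸ MQ) ≃+* MvPolynomial {j : σ // j ∉ Set.range ι} Λ) := by
  classical
  obtain ⟨ε, hε⟩ := exists_quot_t_equiv t q hq hker
  have hsplit : MQ = Ideal.span {t} ⊔ Ideal.span (Set.range vv) := by
    rw [Fin.range_cons, Ideal.span_insert]
  have e1 : (C ⧸ MQ) ≃+* C ⧸ (Ideal.span {t} ⊔ Ideal.span (Set.range vv)) := Ideal.quotEquivOfEq hsplit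
  have e2 : (C ⧸ (Ideal.span {t} ⊔ Ideal.span (Set.range vv))) ≃+*
      (C ⧸ Ideal.span {t}) ⧸ (Ideal.span (Set.range vv)).map (Ideal.Quotient.mk (Ideal.span {t})) :=
    (DoubleQuot.quotQuotEquivQuotSup _ _).symm
  have e3 : ((C ⧸ Ideal.span {t}) ⧸ (Ideal.span (Set.range vv)).map (Ideal.Quotient.mk (Ideal.span {t}))) ≃+*
      MvPolynomial σ Λ ⧸ Ideal.span (MvPolynomial.X '' Set.range ι : Set (MvPolynomial σ Λ)) := by
    refine Ideal.quotientEquiv _ _ ε ?_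
    have hfun : ⇑(ε : (C ⧸ Ideal.span {t}) →+* MvPolynomial σ Λ) ∘ ⇑(Ideal.Quotient.mk (Ideal.span {t})) ∘ vv =
        MvPolynomial.X ∘ ι :=
      funext fun k => by
        change ε (Ideal.Quotient.mk _ (vv k)) = MvPolynomial.X (ι k)
        rw [hε, q_cons p a b q ι hqp hqa hqb]
    rw [Ideal.map_span, Ideal.map_span, ← Set.range_comp, ← Set.range_comp, ← Set.range_comp, hfun]
  have e4 := (MvPolynomial.quotientSpanXEquiv (R := Λ) (Set.range ι)).toRingEquiv
  exact ⟨e1.trans (e2.trans (e3.trans e4))⟩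

/-- `C ⧸ 𝔪_q` is a domain. [cite: StacksProject, Tag 0BIQ] -/
theorem isDomain_quot_MQ [IsDomain Λ] (hq : Function.Surjective q) (hker : RingHom.ker q = Ideal.span {t})
    (hqp : q p = MvPolynomial.X (ι 0)) (hqa : q a = MvPolynomial.X (ι 1))
    (hqb : q b = MvPolynomial.X (ι 2)) : IsDomain (C ⧸ MQ) := by
  obtain ⟨e⟩ := nonempty_quot_MQ_equiv t p a b q ι hq hker hqp hqa hqb
  exact MulEquiv.isDomain _ e.toMulEquiv

/-- `p, a, b ∉ (t)` (they are variables modulo `t`). [folklore] -/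
theorem cons_notMem_span_t [Nontrivial Λ] (hker : RingHom.ker q = Ideal.span {t})
    (hqp : q p = MvPolynomial.X (ι 0)) (hqa : q a = MvPolynomial.X (ι 1))
    (hqb : q b = MvPolynomial.X (ι 2)) (k : Fin 3) : vv k ∉ Ideal.span {t} := by
  intro h
  have h1 : q (vv k) = 0 := by rw [← RingHom.mem_ker, hker]; exact h
  rw [q_cons p a b q ι hqp hqa hqb] at h1
  exact MvPolynomial.X_ne_zero _ h1

/-- `q(h″) = X_{ι0} X_{ι1} + X_{ι2}³`. [folklore] -/
theorem q_hh (hqp : q p = MvPolynomial.X (ι 0)) (hqa : q a = MvPolynomial.X (ι 1))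
    (hqb : q b = MvPolynomial.X (ι 2)) :
    q hh = MvPolynomial.X (ι 0) * MvPolynomial.X (ι 1) + MvPolynomial.X (ι 2) ^ 3 := by
  rw [map_add, map_mul, map_pow, hqp, hqa, hqb]

/-- `X_{ι0} X_{ι1} + X_{ι2}³ ≠ 0` (evaluate at `X_{ι2} = 1`, the rest `0`). [folklore] -/
theorem a2Form_ne_zero [Nontrivial Λ] (hι : Function.Injective ι) :
    (MvPolynomial.X (ι 0) * MvPolynomial.X (ι 1) + MvPolynomial.X (ι 2) ^ 3 : MvPolynomial σ Λ) ≠ 0 := by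
  classical
  intro h
  have h1 := congrArg (MvPolynomial.eval fun i => if i = ι 2 then (1 : Λ) else 0) h
  have h02 : ι 0 ≠ ι 2 := hι.ne (by decide)
  rw [map_add, map_mul, map_pow, map_zero, MvPolynomial.eval_X, MvPolynomial.eval_X, MvPolynomial.eval_X,
    if_neg h02, zero_mul, zero_add, if_pos rfl, one_pow] at h1
  exact one_ne_zero h1

/-- `h″ ∉ (t)`. [folklore] -/
theorem hh_notMem_span_t [Nontrivial Λ] (hker : RingHom.ker q = Ideal.span {t}) (hι : Function.Injective ι)
    (hqp : q p = MvPolynomial.X (ι 0)) (hqa : q a = MvPolynomial.X (ι 1))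
    (hqb : q b = MvPolynomial.X (ι 2)) : hh ∉ Ideal.span {t} := by
  intro h
  have h1 : q hh = 0 := by rw [← RingHom.mem_ker, hker]; exact h
  rw [q_hh p a b q ι hqp hqa hqb] at h1
  exact a2Form_ne_zero ι hι h1

/-- `q(𝔪_q) ≤ (X_ι)` and `(X_ι) ≤ q(𝔪_q)`. [folklore] -/
theorem map_MQ_le_and_ge (hker : RingHom.ker q = Ideal.span {t}) (hqp : q p = MvPolynomial.X (ι 0))
    (hqa : q a = MvPolynomial.X (ι 1)) (hqb : q b = MvPolynomial.X (ι 2)) :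
    (MQ).map q ≤ J ∧ J ≤ (MQ).map q := by
  constructor
  · rw [Ideal.map_span, Ideal.span_le]
    rintro _ ⟨_, ⟨j, rfl⟩, rfl⟩
    refine Fin.cases ?_ (fun k => ?_) j
    · rw [SetLike.mem_coe, Fin.cons_zero, q_t t q hker]; exact Ideal.zero_mem _
    · rw [SetLike.mem_coe, Fin.cons_succ, q_cons p a b q ι hqp hqa hqb]
      exact Ideal.subset_span ⟨ι k, ⟨k, rfl⟩, rfl⟩
  · rw [Ideal.span_le]
    rintro _ ⟨_, ⟨k, rfl⟩, rfl⟩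
    rw [SetLike.mem_coe, ← q_cons p a b q ι hqp hqa hqb k]
    exact Ideal.mem_map_of_mem q (Ideal.subset_span ⟨Fin.succ k, Fin.cons_succ _ _ _⟩)

/-- **THE MODEL of the strict transform of `E = V(t)`**: `C_{k+1} ⧸ (u′) ≅ Λ[X_σ]` with
`ψ(r) ↦ subst_k (q r)` and `e′_{j+1} ↦ X_{ι j}` (`j ≠ k`).
[cite: GortzWedhorn2020, Prop. 13.96 (2) and p. 416] [cite: Hu2025, §5 Prop. 5.3] -/
theorem exists_pointQ_model [IsDomain Λ] (hq : Function.Surjective q) (hker : RingHom.ker q = Ideal.span {t})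
    (hι : Function.Injective ι) (hqp : q p = MvPolynomial.X (ι 0)) (hqa : q a = MvPolynomial.X (ι 1))
    (hqb : q b = MvPolynomial.X (ι 2)) (hqq : IsQuasiRegular qq) (k : Fin 3) :
    ∃ Φ : (chartRing qq (Fin.succ k) ⧸ Ideal.span {chartGen qq (Fin.succ k) 0}) ≃+* MvPolynomial σ Λ,
      (∀ r : C, Φ (Ideal.Quotient.mk _ (chartBase qq (Fin.succ k) r)) =
        coordBlowupSubst Λ (Set.range ι) (ι k) (q r)) ∧
      (∀ j : Fin 3, j ≠ k → Φ (Ideal.Quotient.mk _ (chartGen qq (Fin.succ k) (Fin.succ j))) =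
        MvPolynomial.X (ι j)) := by
  haveI : IsDomain (C ⧸ MQ) := isDomain_quot_MQ t p a b q ι hq hker hqp hqa hqb
  obtain ⟨hIJ, hJI⟩ := map_MQ_le_and_ge t p a b q ι hker hqp hqa hqb
  -- the bridge to the affine blowup algebra
  let τ := blowupAlgebra.toBlowupAlgebra qq (Fin.succ k)
  have hτ := blowupAlgebra.toBlowupAlgebra_bijective qq (Fin.succ k)
  let eτ := RingEquiv.ofBijective τ hτ
  let e1 : (chartRing qq (Fin.succ k) ⧸ Ideal.span {chartGen qq (Fin.succ k) 0}) ≃+*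
      blowupAlgebra MQ (qq (Fin.succ k)) ⧸ Ideal.span {τ (chartGen qq (Fin.succ k) 0)} :=
    Ideal.quotientEquiv _ _ eτ (by rw [Ideal.map_span, Set.image_singleton]; rfl)
  have he1 : ∀ y, e1 (Ideal.Quotient.mk _ y) = Ideal.Quotient.mk _ (τ y) := fun y => rfl
  -- the strict-transform presentation over `q`
  have hf : algebraMap C (blowupAlgebra MQ (qq (Fin.succ k))) t =
      algebraMap C (blowupAlgebra MQ (qq (Fin.succ k))) (qq (Fin.succ k)) ^ 1 * τ (chartGen qq (Fin.succ k) 0) :=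
    strictExc_factor t vv k
  let e2 := quotientKerBlowupAlgebraMapEquiv q J hq hIJ hJI hker hf (strictExc_prime_algebraMap t vv k hqq)
    (strictExc_not_dvd t vv k hqq)
  have he2 : ∀ g, e2 (Ideal.Quotient.mk _ g) = blowupAlgebraMap q MQ J (qq (Fin.succ k)) hIJ g := fun g =>
    quotientKerBlowupAlgebraMapEquiv_mk q J hq hIJ hJI hker hf _ _ g
  have hτr : ∀ r : C, τ (chartBase qq (Fin.succ k) r) = algebraMap C _ r := fun r =>
    blowupAlgebra.toBlowupAlgebra_reesChartBase qq (Fin.succ k) r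
  have hτg : ∀ j : Fin 4, τ (chartGen qq (Fin.succ k) j) = blowupAlgebra.frac qq (Fin.succ k) j := fun j =>
    blowupAlgebra.toBlowupAlgebra_chartGen qq (Fin.succ k) j
  -- Hu's chart
  have hk : q (qq (Fin.succ k)) = MvPolynomial.X (ι k) := by
    rw [Fin.cons_succ]; exact q_cons p a b q ι hqp hqa hqb k
  obtain ⟨E, hEr, hEg⟩ := exists_coordBlowup_model (Set.range ι) (ι k) (q (qq (Fin.succ k))) hk
  refine ⟨e1.trans (e2.trans E), fun r => ?_, fun j hj => ?_⟩
  · show E (e2 (e1 (Ideal.Quotient.mk _ (chartBase qq (Fin.succ k) r)))) = _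
    rw [he1, hτr, he2, blowupAlgebraMap_algebraMap, hEr]
  · show E (e2 (e1 (Ideal.Quotient.mk _ (chartGen qq (Fin.succ k) (Fin.succ j))))) = _
    rw [he1, hτg (Fin.succ j), he2]
    change E (blowupAlgebraMap q MQ J (qq (Fin.succ k)) hIJ
      (blowupAlgebra.gen MQ (qq (Fin.succ k)) (qq (Fin.succ j)) (blowupAlgebra.mem_span_range qq (Fin.succ j)))) = _
    rw [blowupAlgebraMap_gen]
    have hj' : q (qq (Fin.succ j)) = MvPolynomial.X (ι j) := by
      rw [Fin.cons_succ]; exact q_cons p a b q ι hqp hqa hqb j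
    have hx : (MvPolynomial.X (ι j) : MvPolynomial σ Λ) ∈ J := Ideal.subset_span ⟨ι j, ⟨j, rfl⟩, rfl⟩
    have hgen : blowupAlgebra.gen J (q (qq (Fin.succ k))) (q (qq (Fin.succ j)))
        (hIJ (Ideal.mem_map_of_mem q (blowupAlgebra.mem_span_range qq (Fin.succ j)))) =
        blowupAlgebra.gen J (q (qq (Fin.succ k))) (MvPolynomial.X (ι j)) hx :=
      Subtype.ext (by rw [blowupAlgebra.coe_gen, blowupAlgebra.coe_gen, hj'])
    rw [hgen]
    exact hEg (ι j) ⟨j, rfl⟩ (hι.ne hj) hx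

end Model

end TwoPlanesRung

end Summit.ResolutionOfSingularities.ResolutionOfSingularities.Theorems

end
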